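import Literature.Computability.QuantumComplexity.HidingProgram
import HarnessLib

/-!
# The structured answer of the hiding machine of the proof of AA13 Thm. 1.3

Family `quantum-advantage`, a small companion of `HidingProgram.lean`: the answer of the
`FBPP^{NP^𝒪}` machine of the discharge of Aaronson–Arkhipov's Thm. 1.3 written on STRUCTURED data
(an integer array `B'`, positions `S`, counter coins `u`) rather than on strings — the common
currency of the machine's semantics (`HidingSolver.lean`, `postFun_eq_zStruct`) and of the
probabilistic analysis (`HidingGoodEvent.lean`):

* `queryS b_q kβ E = ⟨⟨n, e, b_q, E⟩, 1^{kβ}⟩` (`= IdealParams.hidingQuery`), `instS` (`= countInstance`);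
* `zArr c_𝒪 c_S F b b_q kβ kη kδS B' S u = zOf b n Ñ ℓ (∏ d_{2c+1}) (∏ d_{2c})` with
  `E = hiddenOf b_q B'`, `ℓ = c_𝒪(|x'|)`, `L = c_S(|⟨x', S⟩| + ℓ + kη + kδS)`,
  `Ñ = countEstimate F ⟨x', S⟩ ℓ kη kδS (u ↾ L)`, `d_l = dRec (extFamily B') l`;
* `zStruct … x S B_c u = zArr … (overwrite B_c S x) S u` (the planted array).

All proved (definitions and `rfl`-level dictionary), no new named facts.

## References

* S. Aaronson, A. Arkhipov, *The computational complexity of linear optics*, Theory of Computing 9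
  (2013) 143–252, proof of Thm. 1.3, eqs. (5.80), (5.89), (5.93) (pp. 193–195).
-/

noncomputable section

namespace Literature.Computability.QuantumComplexity

open Polynomial Literature.Computability.Complexity Literature.Computability.Complexity.CodeFP
  Literature.Computability.Cryptography Literature.Combinatorics.Enumerative Literature.Analysis.Matrix
  Literature.Algebra.EuclideanLattices

variable {n e : ℕ}

/-- The padded oracle query of the structured world: `⟨⟨n, e, b_q, E⟩, 1^{kβ}⟩`. [cite: AaronsonArkhipovToC2013, proof of Thm. 1.3 (p. 193)] -/
def queryS (bq kβ : ℕ) (E : Fin (n + e) → Fin n → ℤ × ℤ) : List Bool :=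
  boolPair (encodingBosonInput.encode ⟨n, e, bq, E⟩) (unE kβ)

/-- The counting instance of the structured world: `⟨x', S⟩` (positions as an outcome code).
[cite: AaronsonArkhipovToC2013, proof of Thm. 1.3, eq. (5.80) (p. 193)] -/
def instS (bq kβ : ℕ) (E : Fin (n + e) → Fin n → ℤ × ℤ) (S : Fin n → Fin (n + e)) : List Bool :=
  boolPair (queryS bq kβ E) (encodeBosonOutcome S)

/-- `queryS` is `IdealParams.hidingQuery`. [folklore] -/
theorem queryS_eq_hidingQuery (IP : IdealParams) (E : Fin (n + e) → Fin n → ℤ × ℤ) :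
    queryS IP.b' IP.kβ E = IP.hidingQuery E := rfl

/-- `instS` at an injective position is `IdealParams.countInstance`. [folklore] -/
theorem instS_eq_countInstance (IP : IdealParams) (E : Fin (n + e) → Fin n → ℤ × ℤ) (ι : Fin n ↪ Fin (n + e)) :
    instS IP.b' IP.kβ E ι = IP.countInstance E ι := rfl

/-- **The answer on an integer array `B'`, positions `S`, counter coins `u`**:
`zOf b n Ñ ℓ (∏ d_{2c+1}) (∏ d_{2c})`. [cite: AaronsonArkhipovToC2013, proof of Thm. 1.3, eqs. (5.89), (5.93) (pp. 194–195)] -/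
def zArr (cO cS : Polynomial ℕ) (F : List Bool → List Bool) (b bq kβ kη kδS : ℕ)
    (B' : Fin (n + e) → Fin n → ℤ × ℤ) (S : Fin n → Fin (n + e)) (u : List Bool) : ℤ :=
  ((zOf b n
      (countEstimate F (instS bq kβ (hiddenOf bq B') S) (cO.eval (queryS bq kβ (hiddenOf bq B')).length) kη kδS
        (u.take (cS.eval ((instS bq kβ (hiddenOf bq B') S).length + cO.eval (queryS bq kβ (hiddenOf bq B')).length + kη + kδS))))
      (cO.eval (queryS bq kβ (hiddenOf bq B')).length)
      (∏ c : Fin n, dRec (extFamily B') (2 * c + 1))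
      (∏ c : Fin n, dRec (extFamily B') (2 * c)) : ℕ) : ℤ)

/-- **The answer on the planted data** `(X̃, S, B_c, u)`: `zArr` of the planted array
`overwrite B_c S X̃`. [cite: AaronsonArkhipovToC2013, proof of Thm. 1.3 (p. 194)] -/
def zStruct (cO cS : Polynomial ℕ) (F : List Bool → List Bool) (b bq kβ kη kδS : ℕ)
    (x : Fin n → Fin n → ℤ × ℤ) (S : Fin n → Fin (n + e)) (Bc : Fin (n + e) → Fin n → ℤ × ℤ) (u : List Bool) : ℤ :=
  zArr cO cS F b bq kβ kη kδS (overwrite Bc S x) S u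

/-- **The counter's estimate inside `zArr` is `IdealParams.plantedCountEstimate`** at an injective
position, the coin length is `oracleCoinLen`: `zArr = zOf b n Ñ ℓ (∏ d_odd) (∏ d_even)`. [folklore] -/
theorem zArr_eq (IP : IdealParams) (b : ℕ) (B' : Fin (n + e) → Fin n → ℤ × ℤ) (ι : Fin n ↪ Fin (n + e)) (u : List Bool) :
    zArr IP.c IP.cS IP.F b IP.b' IP.kβ IP.kη IP.kδS B' ι u =
      ((zOf b n (IP.plantedCountEstimate (hiddenOf IP.b' B') ι u) (IP.oracleCoinLen (hiddenOf IP.b' B'))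
        (∏ c : Fin n, dRec (extFamily B') (2 * c + 1)) (∏ c : Fin n, dRec (extFamily B') (2 * c)) : ℕ) : ℤ) := rfl

end Literature.Computability.QuantumComplexity
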